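import Summits.ResolutionOfSingularities.ResolutionOfSingularities.Theorems.LossIsFatalLayer
import HarnessLib

/-!
# LossIsFatalLayer2 — the loss layer along the run (landing part 2 of 2 of the g27 loss-layer calculus)

decomp-res-lens-3, gen 27.  Part 1 (`LossIsFatalLayer`) has the transport algebra (§1), the transport identity /
loss layer along a
walk (§2) and the layer after the proximity repeat (`layer_after_repeat`); this part proves `run_step`,
`run_letter_untranslated`,
`run_step_untranslated`, `kept_of_run`, `run_ledger`, `run_no_side_switch`, `run_invariant` and the two word-level laws
`loss_run_untranslated` (T5a: every later run letter is untranslated) and `loss_run_no_side_switch` (T4⁰: no side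
switch stays on
the loss wall).  See the module docstring of part 1 for the programme and NODE-g27 for the branch table.
-/


open MvPolynomial Finset
open Literature.AlgebraicGeometry.Resolution
open Literature.AlgebraicGeometry.Resolution.Hauser2010
open Literature.AlgebraicGeometry.Resolution.PointBlowup
open Literature.AlgebraicGeometry.Resolution.WeightedBlowup (coeff_translate_monomial coeff_translate_monomial_eq_zero_of_lt
  coeff_translate_monomial_eq_zero_of_apply_eq_zero)
open Summit.ResolutionOfSingularities.ResolutionOfSingularities.Theorems.TightDefectClasses
open Summit.ResolutionOfSingularities.ResolutionOfSingularities.Theorems.TightDefectStrongWalks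
open Summit.ResolutionOfSingularities.ResolutionOfSingularities.Theorems.ItineraryCutClasses
open Summit.ResolutionOfSingularities.ResolutionOfSingularities.Theorems.BoundaryLedger
open Summit.ResolutionOfSingularities.ResolutionOfSingularities.Theorems.ProximityCut
open Summit.ResolutionOfSingularities.ResolutionOfSingularities.Theorems.WallCutRun
open Summit.ResolutionOfSingularities.ResolutionOfSingularities.Theorems.WallCut
open Summit.ResolutionOfSingularities.ResolutionOfSingularities.Theorems.ConeCut (resForm resLayer initLayer bUnit bUnit_ne_zero
  cone_of_plateau resForm_eq_pow_of_repeat coeff_step_layer initLayer_eq_mul update_apply' coeff_resForm_eq_zero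
  translate_monomial_eq_self)


namespace Summit.ResolutionOfSingularities.ResolutionOfSingularities.Theorems.LossIsFatalLayer

section Walk

variable {K : Type} [Field K] [DecidableEq K] {q : ℕ} {s₀ : State (Fin 3) K}

/-! ## §3 (continued) The loss layer along the run: transport per letter, rigidity, the run invariant, the laws -/

/-- **TRANSPORT OF THE LOSS LAYER THROUGH ONE RUN LETTER (PROVED).**  If the `u_j^m`-layer of `F_u` is
`c · u_i^k u_j^m u_l^s · V` and move `u` is in chart `i` staying on the wall `E_j` (`b_u(j) = 0`), then the `u_j^m`-layer of
`F_{u+1}` is `c · u_i^{E} u_j^m · (u_l + γ)^s · ΨV`, `γ = b_u(l)` (`k + m + s = q + E`; in a run after a loss with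
`m + s = q + d` one has `E = k + d`). [new] [folklore] -/
theorem run_step (hroot : IsRoot q s₀) (W : ForcedWalk q s₀) (u : ℕ) {j l : Fin 3} {k m s E : ℕ} {c : K}
    {V : MvPolynomial (Fin 3) K} (hji : j ≠ W.j u) (hli : l ≠ W.j u) (hlj : l ≠ j) (hbj : W.b u j = 0)
    (h1m : 1 ≤ m) (hmq : m < q) (hE : k + m + s = q + E)
    (hlayer : ∀ D : Fin 3 →₀ ℕ, D j = m → coeff D (W.st u).F =
      coeff D (monomial (Finsupp.single (W.j u) k + Finsupp.single j m + Finsupp.single l s) c * V)) :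
    ∀ D : Fin 3 →₀ ℕ, D j = m → coeff D (W.st (u + 1)).F =
      coeff D (monomial (Finsupp.single (W.j u) E + Finsupp.single j m) c *
        ((X l + C (W.b u l)) ^ s * PointBlowup.translate (W.b u) (chartMap (W.j u) V))) := by
  classical
  intro D hD
  have hbi : W.b u (W.j u) = 0 := W.onExc u
  rw [coeff_succ_transport hroot W u D (not_isPthPowerExponent_of_lt hD h1m hmq),
    coeff_transport_congr hji (W.b u) hbj _ _ hlayer (Finsupp.single (W.j u) q + D)
      (by rw [Finsupp.add_apply, Finsupp.single_apply, if_neg hji.symm, zero_add, hD])]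
  set i := W.j u with hi
  set b := W.b u with hb
  have hmono : (monomial (Finsupp.single i q + (Finsupp.single i E + Finsupp.single j m)) c : MvPolynomial (Fin 3) K) =
      monomial (Finsupp.single i q) 1 * monomial (Finsupp.single i E + Finsupp.single j m) c := by
    rw [monomial_mul, one_mul]
  have hΨ : PointBlowup.translate b (chartMap i (monomial (Finsupp.single i k + Finsupp.single j m + Finsupp.single l s) c * V)) =
      monomial (Finsupp.single i q) 1 * (monomial (Finsupp.single i E + Finsupp.single j m) c *
        ((X l + C (b l)) ^ s * PointBlowup.translate b (chartMap i V))) := by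
    rw [map_mul, translate_mul, chartMap_monomial, chartExponent_zero_three hji.symm hli hlj,
      translate_monomial_split b l hbi hbj, hE, Finsupp.single_add, add_assoc, hmono,
      mul_assoc, mul_assoc]
  rw [hΨ, coeff_monomial_mul, one_mul]

/-- **RIGIDITY OF A RUN LETTER (PROVED): it is UNTRANSLATED.**  In the situation of `run_step` with `c ≠ 0`, `V(0) ≠ 0`,
if the witness degree `E + m` is below the next order then `b_u(l) = 0`: otherwise `F_{u+1}` would contain the
monomial `u_i^{E} u_j^m` with coefficient `c γ^s V(0) ≠ 0` strictly below its order. [new] [folklore] -/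
theorem run_letter_untranslated (hroot : IsRoot q s₀) (W : ForcedWalk q s₀) (u : ℕ) {j l : Fin 3} {k m s E : ℕ} {c : K}
    {V : MvPolynomial (Fin 3) K} (hji : j ≠ W.j u) (hli : l ≠ W.j u) (hlj : l ≠ j) (hbj : W.b u j = 0)
    (h1m : 1 ≤ m) (hmq : m < q) (hE : k + m + s = q + E)
    (hlayer : ∀ D : Fin 3 →₀ ℕ, D j = m → coeff D (W.st u).F =
      coeff D (monomial (Finsupp.single (W.j u) k + Finsupp.single j m + Finsupp.single l s) c * V))
    (hc : c ≠ 0) (hV : constantCoeff V ≠ 0) {o₁ : ℕ} (ho₁ : ordZero (W.st (u + 1)).F = o₁) (hdeg : E + m < o₁) :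
    W.b u l = 0 := by
  classical
  by_contra hγ
  have hD₀j : (Finsupp.single (W.j u) E + Finsupp.single j m) j = m := by
    rw [Finsupp.add_apply, Finsupp.single_apply, if_neg hji.symm, Finsupp.single_eq_same, zero_add]
  have h := run_step hroot W u hji hli hlj hbj h1m hmq hE hlayer _ hD₀j
  rw [coeff_monomial_mul', if_pos le_rfl, tsub_self] at h
  have hcc : coeff 0 ((X l + C (W.b u l)) ^ s * PointBlowup.translate (W.b u) (chartMap (W.j u) V)) =
      W.b u l ^ s * constantCoeff V := by
    show constantCoeff _ = _
    rw [map_mul, map_pow, map_add, constantCoeff_X, constantCoeff_C, zero_add, constantCoeff_transport _ _ (W.onExc u)]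
  rw [hcc] at h
  have hne : coeff (Finsupp.single (W.j u) E + Finsupp.single j m) (W.st (u + 1)).F ≠ 0 := by
    rw [h]; exact mul_ne_zero hc (mul_ne_zero (pow_ne_zero _ hγ) hV)
  refine hne (coeff_eq_zero_of_degree_lt_ordZero ?_)
  have hdD : (Finsupp.single (W.j u) E + Finsupp.single j m).degree = E + m := by
    rw [map_add, Finsupp.degree_single, Finsupp.degree_single]
  rw [ho₁, hdD]
  exact_mod_cast hdeg

/-- After an UNTRANSLATED run letter the layer shape persists: `c · u_i^{E} u_j^m u_l^s · ΨV`, and `(ΨV)(0) = V(0)`.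
[new] [folklore] -/
theorem run_step_untranslated (hroot : IsRoot q s₀) (W : ForcedWalk q s₀) (u : ℕ) {j l : Fin 3} {k m s E : ℕ} {c : K}
    {V : MvPolynomial (Fin 3) K} (hji : j ≠ W.j u) (hli : l ≠ W.j u) (hlj : l ≠ j) (hbj : W.b u j = 0)
    (h1m : 1 ≤ m) (hmq : m < q) (hE : k + m + s = q + E)
    (hlayer : ∀ D : Fin 3 →₀ ℕ, D j = m → coeff D (W.st u).F =
      coeff D (monomial (Finsupp.single (W.j u) k + Finsupp.single j m + Finsupp.single l s) c * V))
    (hγ : W.b u l = 0) :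
    ∀ D : Fin 3 →₀ ℕ, D j = m → coeff D (W.st (u + 1)).F =
      coeff D (monomial (Finsupp.single (W.j u) E + Finsupp.single j m + Finsupp.single l s) c *
        PointBlowup.translate (W.b u) (chartMap (W.j u) V)) := by
  intro D hD
  rw [run_step hroot W u hji hli hlj hbj h1m hmq hE hlayer D hD, hγ, C_0, add_zero, X_pow_eq_monomial, ← mul_assoc,
    monomial_mul, mul_one]

/-- The kept walls of a run letter on the wall `E_j`: only `E_j` (mass `m`). [folklore] -/
theorem kept_of_run (W : ForcedWalk q s₀) (u : ℕ) {j : Fin 3} {k m : ℕ} (hji : j ≠ W.j u) (hbj : W.b u j = 0)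
    (hr : (W.st u).r = Finsupp.single (W.j u) k + Finsupp.single j m) : kept W u = Finsupp.single j m := by
  classical
  ext w
  rw [kept_apply, hr, Finsupp.add_apply, Finsupp.single_apply, Finsupp.single_apply]
  by_cases hw : w = j
  · rw [hw, if_pos ⟨hji, hbj⟩, if_neg (fun h : W.j u = j => hji h.symm), if_pos rfl, zero_add]
  · rw [if_neg (fun h : j = w => hw h.symm)]
    by_cases hwi : w = W.j u
    · rw [if_neg (fun h => h.1 hwi)]
    · rw [if_neg (fun h : W.j u = w => hwi h.symm), add_zero]
      split_ifs <;> rfl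

/-- **THE RUN LEDGER (PROVED).**  A run letter at `u` in chart `i` on the wall `E_j` from `r_u = k e_i + m e_j` on a shade-`s`
plateau: `ordZero F_u = s + k + m` and `r_{u+1} = (k + d) e_i + m e_j` with `m + s = q + d` — whatever the translation along
the third coordinate (that wall is empty). [folklore] -/
theorem run_ledger (hroot : IsRoot q s₀) (W : ForcedWalk q s₀) (u : ℕ) {j : Fin 3} {k m d s : ℕ} (hji : j ≠ W.j u)
    (hbj : W.b u j = 0) (hms : m + s = q + d) (hsh : (W.st u).shade = (s : ℕ∞))
    (hr : (W.st u).r = Finsupp.single (W.j u) k + Finsupp.single j m) :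
    ordZero (W.st u).F = ((s + k + m : ℕ) : ℕ∞) ∧
      (W.st (u + 1)).r = Finsupp.single (W.j u) (k + d) + Finsupp.single j m := by
  classical
  obtain ⟨o, ho, -⟩ := walk_nat hroot W u
  obtain ⟨n, hn, hon⟩ := order_eq_shade_add_degree hroot W u ho
  have hns : n = s := by have h := hn.symm.trans hsh; exact_mod_cast h
  have hdeg : (W.st u).r.degree = k + m := by rw [hr, map_add, Finsupp.degree_single, Finsupp.degree_single]
  have hoe : o = s + k + m := by rw [hon, hns, hdeg, add_assoc]
  refine ⟨by rw [ho, hoe], ?_⟩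
  rw [r_succ_eq W u ho, kept_of_run W u hji hbj hr, show o - q = k + d by omega]
  exact add_comm _ _

/-- **NO SIDE SWITCH ON THE LOSS WALL (PROVED, hypothesis-free).**  At a run stage `u` — boundary `r_u = k e_i + m e_j`,
`u_j^m`-layer of `F_u` equal to `c · u_l^s u_j^m u_i^k · V` with `c ≠ 0`, `V(0) ≠ 0` (written with the chart letter first),
`m + s = q + d`, `1 ≤ m < q` — a move in the THIRD chart `l` that stays on the loss wall (`b_u(j) = 0`) contradicts the shade
plateau at `u`, `u+1`: the move is first forced untranslated along `u_i` (`run_letter_untranslated`), and then the transported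
layer monomial `c V(0) · u_l^{k+d} u_j^m u_i^k` of `F_{u+1}` has degree `2k + m + d < ordZero F_{u+1} = s + 2k + m + d`.
(So the wall-stay phase after a total loss consists of chart-`i` letters only.) [new] [folklore] -/
theorem run_no_side_switch (hroot : IsRoot q s₀) (W : ForcedWalk q s₀) (u : ℕ) {i j : Fin 3} {k m d s : ℕ} {c : K}
    {V : MvPolynomial (Fin 3) K} (hji : j ≠ W.j u) (hiu : i ≠ W.j u) (hij : i ≠ j) (hbj : W.b u j = 0)
    (h1m : 1 ≤ m) (hmq : m < q) (hms : m + s = q + d)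
    (hsh0 : (W.st u).shade = (s : ℕ∞)) (hsh1 : (W.st (u + 1)).shade = (s : ℕ∞))
    (hr : (W.st u).r = Finsupp.single i k + Finsupp.single j m)
    (hlayer : ∀ D : Fin 3 →₀ ℕ, D j = m → coeff D (W.st u).F =
      coeff D (monomial (Finsupp.single (W.j u) s + Finsupp.single j m + Finsupp.single i k) c * V))
    (hc : c ≠ 0) (hV : constantCoeff V ≠ 0) : False := by
  classical
  have hE : s + m + k = q + (k + d) := by omega
  -- the ledger of the move
  obtain ⟨o, ho, -⟩ := walk_nat hroot W u
  obtain ⟨n, hn, hon⟩ := order_eq_shade_add_degree hroot W u ho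
  have hns : n = s := by have h := hn.symm.trans hsh0; exact_mod_cast h
  have hdeg : (W.st u).r.degree = k + m := by rw [hr, map_add, Finsupp.degree_single, Finsupp.degree_single]
  obtain ⟨o₁, ho₁, -⟩ := walk_nat hroot W (u + 1)
  obtain ⟨n₁, hn₁, hon₁⟩ := order_eq_shade_add_degree hroot W (u + 1) ho₁
  have hn₁s : n₁ = s := by have h := hn₁.symm.trans hsh1; exact_mod_cast h
  have hdeg₁ := degree_r_succ W u ho
  have hkj : kept W u j = m := by
    rw [kept_apply, if_pos ⟨hji, hbj⟩, hr, Finsupp.add_apply, Finsupp.single_apply, if_neg hij, Finsupp.single_eq_same,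
      zero_add]
  have hmk : m ≤ (kept W u).degree := by rw [← hkj]; exact Finsupp.le_degree _ _
  -- step 1: the move is untranslated along `u_i`
  have hβ : W.b u i = 0 :=
    run_letter_untranslated hroot W u hji hiu hij hbj h1m hmq hE hlayer hc hV ho₁ (by omega)
  -- step 2: the transported layer monomial lies strictly below the order of `F_{u+1}`
  have hnext := run_step_untranslated hroot W u hji hiu hij hbj h1m hmq hE hlayer hβ
  have hDj : (Finsupp.single (W.j u) (k + d) + Finsupp.single j m + Finsupp.single i k) j = m := by
    rw [Finsupp.add_apply, Finsupp.add_apply, Finsupp.single_apply, if_neg hji.symm, Finsupp.single_eq_same,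
      Finsupp.single_apply, if_neg hij, zero_add, add_zero]
  have h := hnext _ hDj
  have hcm := coeff_monomial_mul 0 (Finsupp.single (W.j u) (k + d) + Finsupp.single j m + Finsupp.single i k) c
    (PointBlowup.translate (W.b u) (chartMap (W.j u) V))
  rw [add_zero] at hcm
  have hcc : coeff 0 (PointBlowup.translate (W.b u) (chartMap (W.j u) V)) = constantCoeff V := by
    show constantCoeff _ = _
    exact constantCoeff_transport _ _ (W.onExc u) _
  rw [hcm, hcc] at h
  have hne : coeff (Finsupp.single (W.j u) (k + d) + Finsupp.single j m + Finsupp.single i k) (W.st (u + 1)).F ≠ 0 := by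
    rw [h]; exact mul_ne_zero hc hV
  refine hne (coeff_eq_zero_of_degree_lt_ordZero ?_)
  have hkept : kept W u = (W.st u).r := by
    ext w
    rw [kept_apply]
    by_cases hw : w = W.j u
    · rw [if_neg (fun h => h.1 hw), hw, hr, Finsupp.add_apply, Finsupp.single_apply, if_neg hiu, Finsupp.single_apply,
        if_neg hji, add_zero]
    · rcases ExitLaw.fin3_cases hij hiu.symm hji.symm w with hw' | hw' | hw'
      · rw [if_pos ⟨hw, by rw [hw']; exact hβ⟩]
      · rw [if_pos ⟨hw, by rw [hw']; exact hbj⟩]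
      · exact absurd hw' hw
  have hdD : (Finsupp.single (W.j u) (k + d) + Finsupp.single j m + Finsupp.single i k).degree = k + d + m + k := by
    rw [map_add, map_add, Finsupp.degree_single, Finsupp.degree_single, Finsupp.degree_single]
  rw [ho₁, hdD]
  rw [hkept, hdeg] at hdeg₁
  exact_mod_cast (show k + d + m + k < o₁ by omega)

/-- **THE RUN INVARIANT (PROVED).**  After a total loss at `t` in chart `j` (`ordZero F_t = q + m`, `m ≥ 1`, the new wall the
only wall, `ordZero F_{t+1} ≠ q`) and a proximity repeat into chart `i` at `t+1` (possibly translated along the third coordinate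
`u_l`), followed by `n` letters `t+2, …, t+1+n` in chart `i` on the wall `E_j`, all on one shade plateau: at every stage
`u = t+2+a`, `a ≤ n`, all earlier letters `t+2, …, t+1+a` were untranslated, the boundary is `k e_i + m e_j`, and
the `u_j^m`-layer
of `F_u` is `c · u_i^k u_j^m u_l^s · V` with one fixed `c ≠ 0` and `V(0) ≠ 0`; also `m < q` and `q + 1 ≤ m + s`.
[new] [folklore] -/
theorem run_invariant (hroot : IsRoot q s₀) (W : ForcedWalk q s₀) (t : ℕ) {s m n : ℕ} {l : Fin 3}
    (hsh : ∀ a, a ≤ n + 2 → (W.st (t + a)).shade = (s : ℕ∞))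
    (hot : ordZero (W.st t).F = ((q + m : ℕ) : ℕ∞)) (h1m : 1 ≤ m)
    (hloss : ∀ y, y ≠ W.j t → (W.st (t + 1)).r y = 0) (hne1 : ordZero (W.st (t + 1)).F ≠ (q : ℕ∞))
    (hst : StaysOnNewest W t) (hli : l ≠ W.j (t + 1)) (hlj : l ≠ W.j t)
    (hrun : ∀ a, a < n → W.j (t + 2 + a) = W.j (t + 1) ∧ W.b (t + 2 + a) (W.j t) = 0) :
    m < q ∧ q + 1 ≤ m + s ∧ ∃ c : K, c ≠ 0 ∧ ∀ a, a ≤ n → (∀ a', a' < a → W.b (t + 2 + a') = 0) ∧ ∃ k : ℕ,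
      (W.st (t + 2 + a)).r = Finsupp.single (W.j (t + 1)) k + Finsupp.single (W.j t) m ∧
      ∃ V' : MvPolynomial (Fin 3) K, constantCoeff V' ≠ 0 ∧ ∀ D : Fin 3 →₀ ℕ, D (W.j t) = m →
        coeff D (W.st (t + 2 + a)).F =
          coeff D (monomial (Finsupp.single (W.j (t + 1)) k + Finsupp.single (W.j t) m + Finsupp.single l s) c * V') := by
  classical
  -- the loss data
  have hmq : m < q := by
    obtain ⟨o₁, ho₁, -, ho2⟩ := NoJump.order_lt_two_mul hroot W t
    have : o₁ = q + m := by have h := ho₁.symm.trans hot; exact_mod_cast h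
    omega
  have hji : W.j t ≠ W.j (t + 1) := fun h => hst.1 h.symm
  have hr1 : (W.st (t + 1)).r = Finsupp.single (W.j t) m := by
    ext y
    by_cases hy : y = W.j t
    · rw [hy, r_succ_eq W t hot, Finsupp.add_apply, Finsupp.single_eq_same, Finsupp.single_eq_same, kept_apply,
        if_neg (fun h => h.1 rfl), zero_add, Nat.add_sub_cancel_left]
    · rw [hloss y hy, Finsupp.single_apply, if_neg (fun h => hy h.symm)]
  have hk : kept W t = 0 := by
    have h := r_succ_eq W t hot
    rw [hr1, Nat.add_sub_cancel_left] at h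
    exact add_right_cancel (h.symm.trans (zero_add _).symm)
  have hsh0 : (W.st t).shade = (s : ℕ∞) := by have h := hsh 0 (Nat.zero_le _); rwa [add_zero] at h
  obtain ⟨o1, ho1, hqo1⟩ := walk_nat hroot W (t + 1)
  obtain ⟨n1, hn1, hon1⟩ := order_eq_shade_add_degree hroot W (t + 1) ho1
  have hn1s : n1 = s := by have h := hn1.symm.trans (hsh 1 (by omega)); exact_mod_cast h
  have hdeg1 : (W.st (t + 1)).r.degree = m := by rw [hr1, Finsupp.degree_single]
  have ho1q : o1 ≠ q := fun h => hne1 (by rw [ho1, h])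
  -- the defect parameter `d = s + m − q ≥ 1`
  obtain ⟨d, hd⟩ : ∃ d : ℕ, m + s = q + d := ⟨s + m - q, by omega⟩
  have h1d : 1 ≤ d := by omega
  have hot1 : ordZero (W.st (t + 1)).F = ((q + d : ℕ) : ℕ∞) := by
    rw [ho1]; exact_mod_cast (show o1 = q + d by omega)
  have hplat : (W.st (t + 1)).shade = (W.st t).shade := by rw [hsh 1 (by omega), hsh0]
  have hplat' : (W.st (t + 2)).shade = (W.st (t + 1)).shade := by rw [hsh 2 (by omega), hsh 1 (by omega)]
  obtain ⟨c, hc, V, hV, hlay⟩ := layer_after_repeat hroot W t hsh0 hplat hplat' hot hot1 h1m h1d hd hk hst hli hlj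
  -- the boundary after the repeat: `r_{t+2} = d e_i + m e_j`
  have hr2 : (W.st (t + 2)).r = Finsupp.single (W.j (t + 1)) d + Finsupp.single (W.j t) m := by
    have hk1 : kept W (t + 1) = Finsupp.single (W.j t) m := by
      refine kept_of_run W (t + 1) hji hst.2 (k := 0) ?_
      rw [hr1, Finsupp.single_zero, zero_add]
    show (W.st (t + 1 + 1)).r = _
    rw [r_succ_eq W (t + 1) ho1, hk1, show o1 - q = d by omega]
    exact add_comm _ _
  refine ⟨hmq, by omega, c, hc, ?_⟩
  intro a
  induction a with
  | zero =>
    intro _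
    exact ⟨fun a' h => absurd h (Nat.not_lt_zero _), d, by simpa using hr2, V, hV, by simpa using hlay⟩
  | succ a ih =>
    intro ha
    obtain ⟨hprev, k, hr, V', hV', hlay'⟩ := ih (by omega)
    obtain ⟨hja, hbja⟩ := hrun a (by omega)
    have hji' : W.j t ≠ W.j (t + 2 + a) := by rw [hja]; exact hji
    have hli' : l ≠ W.j (t + 2 + a) := by rw [hja]; exact hli
    have hr' : (W.st (t + 2 + a)).r = Finsupp.single (W.j (t + 2 + a)) k + Finsupp.single (W.j t) m := by
      rw [hja]; exact hr
    have hlay'' : ∀ D : Fin 3 →₀ ℕ, D (W.j t) = m → coeff D (W.st (t + 2 + a)).F =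
        coeff D (monomial (Finsupp.single (W.j (t + 2 + a)) k + Finsupp.single (W.j t) m + Finsupp.single l s) c *
          V') := by
      rw [hja]; exact hlay'
    have hshu : (W.st (t + 2 + a)).shade = (s : ℕ∞) := by
      have h := hsh (2 + a) (by omega); rwa [← add_assoc] at h
    have hshu1 : (W.st (t + 2 + a + 1)).shade = (s : ℕ∞) := by
      have h := hsh (3 + a) (by omega); rwa [show t + (3 + a) = t + 2 + a + 1 by omega] at h
    obtain ⟨-, hrnext⟩ := run_ledger hroot W (t + 2 + a) hji' hbja hd hshu hr'
    obtain ⟨o₁, ho₁, -⟩ := walk_nat hroot W (t + 2 + a + 1)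
    obtain ⟨n₁, hn₁, hon₁⟩ := order_eq_shade_add_degree hroot W (t + 2 + a + 1) ho₁
    have hn₁s : n₁ = s := by have h := hn₁.symm.trans hshu1; exact_mod_cast h
    have hdeg₁ : (W.st (t + 2 + a + 1)).r.degree = k + d + m := by
      rw [hrnext, map_add, Finsupp.degree_single, Finsupp.degree_single]
    have hγ := run_letter_untranslated hroot W (t + 2 + a) hji' hli' hlj hbja h1m hmq
      (show k + m + s = q + (k + d) by omega) hlay'' hc hV' ho₁ (by omega)
    have hnext := run_step_untranslated hroot W (t + 2 + a) hji' hli' hlj hbja h1m hmq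
      (show k + m + s = q + (k + d) by omega) hlay'' hγ
    refine ⟨fun a' ha' => ?_, k + d, ?_, PointBlowup.translate (W.b (t + 2 + a)) (chartMap (W.j (t + 2 + a)) V'), ?_, ?_⟩
    · by_cases h : a' < a
      · exact hprev a' h
      · have ha'a : a' = a := by omega
        rw [ha'a]
        funext w
        simp only [Pi.zero_apply]
        rcases ExitLaw.fin3_cases hji hlj hli w with hw | hw | hw
        · rw [hw]; exact hbja
        · rw [hw, ← hja]; exact W.onExc (t + 2 + a)
        · rw [hw]; exact hγ
    · show (W.st (t + 2 + a + 1)).r = _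
      rw [hrnext, hja]
    · rw [constantCoeff_transport _ _ (W.onExc (t + 2 + a))]; exact hV'
    · intro D hD
      rw [show t + 2 + (a + 1) = t + 2 + a + 1 by omega, hnext D hD, hja]

/-- **T5a — A RUN AFTER A TOTAL LOSS IS STRAIGHT FROM ITS SECOND LETTER (PROVED, hypothesis-free, every `q = pᵉ`, every
defect, no horizon).**  In the situation of `run_invariant`: every one of the letters `t+2, …, t+1+n` is UNTRANSLATED
(`b = 0`).  A translation `γ ≠ 0` along `u_l` at a run letter `u` would put the monomial `c γ^s V(0) · u_i^{k+d} u_j^m` of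
degree `k + d + m < ordZero F_{u+1} = s + k + d + m` into `F_{u+1}`. [new] [folklore] -/
theorem loss_run_untranslated (hroot : IsRoot q s₀) (W : ForcedWalk q s₀) (t : ℕ) {s m n : ℕ} {l : Fin 3}
    (hsh : ∀ a, a ≤ n + 2 → (W.st (t + a)).shade = (s : ℕ∞))
    (hot : ordZero (W.st t).F = ((q + m : ℕ) : ℕ∞)) (h1m : 1 ≤ m)
    (hloss : ∀ y, y ≠ W.j t → (W.st (t + 1)).r y = 0) (hne1 : ordZero (W.st (t + 1)).F ≠ (q : ℕ∞))
    (hst : StaysOnNewest W t) (hli : l ≠ W.j (t + 1)) (hlj : l ≠ W.j t)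
    (hrun : ∀ a, a < n → W.j (t + 2 + a) = W.j (t + 1) ∧ W.b (t + 2 + a) (W.j t) = 0) :
    ∀ a, a < n → W.b (t + 2 + a) = 0 := by
  obtain ⟨-, -, c, -, key⟩ := run_invariant hroot W t hsh hot h1m hloss hne1 hst hli hlj hrun
  exact (key n le_rfl).1

/-- **T4⁰ — NO SIDE SWITCH AFTER A RUN (PROVED, hypothesis-free, every `q = pᵉ`, every defect).**  In the situation of
`run_invariant` (loss at `t`, repeat at `t+1`, run letters `t+2, …, t+1+n`), the letter `t+2+n` is NOT a move in the third
chart `l` staying on the loss wall `E_j` — if the plateau persists through `t+3+n`. [new] [folklore] -/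
theorem loss_run_no_side_switch (hroot : IsRoot q s₀) (W : ForcedWalk q s₀) (t : ℕ) {s m n : ℕ} {l : Fin 3}
    (hsh : ∀ a, a ≤ n + 3 → (W.st (t + a)).shade = (s : ℕ∞))
    (hot : ordZero (W.st t).F = ((q + m : ℕ) : ℕ∞)) (h1m : 1 ≤ m)
    (hloss : ∀ y, y ≠ W.j t → (W.st (t + 1)).r y = 0) (hne1 : ordZero (W.st (t + 1)).F ≠ (q : ℕ∞))
    (hst : StaysOnNewest W t) (hli : l ≠ W.j (t + 1)) (hlj : l ≠ W.j t)
    (hrun : ∀ a, a < n → W.j (t + 2 + a) = W.j (t + 1) ∧ W.b (t + 2 + a) (W.j t) = 0)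
    (hl : W.j (t + 2 + n) = l) (hbj : W.b (t + 2 + n) (W.j t) = 0) : False := by
  classical
  obtain ⟨hmq, hqs, c, hc, key⟩ :=
    run_invariant hroot W t (fun a ha => hsh a (by omega)) hot h1m hloss hne1 hst hli hlj hrun
  obtain ⟨-, k, hr, V', hV', hlay⟩ := key n le_rfl
  obtain ⟨d, hd⟩ : ∃ d : ℕ, m + s = q + d := ⟨m + s - q, by omega⟩
  have hshu : (W.st (t + 2 + n)).shade = (s : ℕ∞) := by
    have h := hsh (2 + n) (by omega); rwa [← add_assoc] at h
  have hshu1 : (W.st (t + 2 + n + 1)).shade = (s : ℕ∞) := by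
    have h := hsh (3 + n) (by omega); rwa [show t + (3 + n) = t + 2 + n + 1 by omega] at h
  have hperm : Finsupp.single (W.j (t + 1)) k + Finsupp.single (W.j t) m + Finsupp.single l s =
      Finsupp.single l s + Finsupp.single (W.j t) m + Finsupp.single (W.j (t + 1)) k := by
    rw [add_comm (Finsupp.single (W.j (t + 1)) k) _, add_comm _ (Finsupp.single l s), ← add_assoc]
  refine run_no_side_switch hroot W (t + 2 + n) (i := W.j (t + 1)) (j := W.j t) (by rw [hl]; exact hlj.symm)
    (by rw [hl]; exact hli.symm) hst.1 hbj h1m hmq hd hshu hshu1 hr ?_ hc hV'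
  intro D hD
  rw [hlay D hD, hperm, hl]

end Walk

end Summit.ResolutionOfSingularities.ResolutionOfSingularities.Theorems.LossIsFatalLayer
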